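import Mathlib
import Summits.NavierStokesRegularity.NavierStokesRegularity.Theorems.FilamentSkeletonRssStadiumCornerRightNear
import Summits.NavierStokesRegularity.NavierStokesRegularity.Theorems.FilamentSkeletonRssStadiumCornerQuantVariance
import Summits.NavierStokesRegularity.NavierStokesRegularity.Theorems.FilamentSkeletonRssStadiumCornerQuantFeet

/-!
# Route `FilamentSkeletonRss` · cruxes `SkeletonJ1L` (stmt-NavierStokesRegularity-23296, registered stub `stub_tangentSkeletonL` ≡
# `TangentSkeletonNearStraightL`, stmt-23320) · line `child_tangent_analytic_strip_L` (b0b56c52900dd90a), stub `stub_stripPropagation` —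
# brick for `rcore`: POSITIVITY ALONG THE RIGHT WING OF A CORNER ANCHOR'S TENT, IN SEGMENT FORM

The freeze bricks (`Theorems.StadiumFrozenSegmentNhds`, `…FrozenPolygon`, `…AnchorTube`, `…TentFreezeNhds`) take POINTWISE POSITIVITY at the anchor
along each segment `t ↦ p + t(q − p)`, `t ∈ [0,1]`.  For a corner-normalised anchor `z₀ = x₀ + iY₀` (`0 ≤ Y₀ < hs/4`, `cc ≤ x₀ < cc + L + hs/4`)
the RIGHT WING of its tent is the short plateau `[z₀, z₀ + hs/5]` and the descent `[z₀ + hs/5, x₀ + hs/2]`; this file rewrites the landed corner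
certificates into that segment form:
* `right_plateau_pos` — `Theorems.StadiumCornerRightNear.corner_right_plateau_re_pos` (`D = t·hs/5`), with a core of positive real part;
* `right_descent_pos` — `corner_right_descent_near_re_pos` (`t ≤ 2/5`), `Theorems.StadiumCornerQuantVariance.corner_right_descent_mid_re_ge`
  (`2/5 ≤ t ≤ 11/20`), `Theorems.StadiumCornerQuantFeet.corner_right_descent_far_re_ge` (`11/20 ≤ t ≤ 1`), glued over `[0,1]`;
* `right_wing_in_stadium` — both segments lie in the stadium.
So `frozenPolygon_nhds` / `anchor_tube_polygon` apply to the right wing of every corner anchor with no further input.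
HONEST FRAMING: bookkeeping for a HYPOTHETICAL filament skeleton on the NEGATIVE side of a MODEL route; the stub `stub_stripPropagation` is NOT closed
by this file, `TangentSkeletonNearStraightL` / `SkeletonJ1L` stay OPEN; nothing here bears on Navier–Stokes regularity or blow-up.
`--supports stmt-NavierStokesRegularity-23320` (≡ stub `stub_tangentSkeletonL` of 23296).
-/

set_option linter.dupNamespace false

noncomputable section

namespace Summit.NavierStokesRegularity.NavierStokesRegularity.Theorems.StadiumRightWingPos

open Set Complex
open scoped InnerProductSpace
open Summit.NavierStokesRegularity.NavierStokesRegularity.Theorems.StadiumCornerRightNear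
open Summit.NavierStokesRegularity.NavierStokesRegularity.Theorems.StadiumCornerQuantVariance
open Summit.NavierStokesRegularity.NavierStokesRegularity.Theorems.StadiumCornerQuantFeet

/-- **The short plateau of a corner anchor, in segment form.**  `p = z₀ = x₀ + iY₀`, `q = z₀ + hs/5`; for `t ∈ [0,1]` and any core value of
real part `≥ g₀ > 0`: `0 < Re(Σᵢ (Fᵢ z₀ − Fᵢ(p + t(q−p)))² + κ·G(p + t(q−p)))`. [folklore] -/
theorem right_plateau_pos {hs L cc : ℝ} {F : ℂ → (Fin 3 → ℂ)}
    (hF : DifferentiableOn ℂ F {z : ℂ | |z.im| < hs ∧ |z.re - cc| < L + hs})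
    (hM : ∀ z ∈ {z : ℂ | |z.im| < hs ∧ |z.re - cc| < L + hs}, ‖deriv F z‖ ≤ 2)
    (hunit : ∀ w ∈ {z : ℂ | |z.im| < hs ∧ |z.re - cc| < L + hs}, ∑ i, (deriv F w i) ^ 2 = 1)
    (hhs : 0 < hs) {x₀ Y₀ : ℝ} (hY : |Y₀| < hs / 4) (hx₀ : x₀ < cc + L + hs / 4) (hx₀cc : cc ≤ x₀)
    {G : ℂ → ℂ} {κ g₀ : ℝ} (hκ : 0 < κ) (hg₀ : 0 < g₀)
    (hG : ∀ w ∈ {z : ℂ | |z.im| < hs ∧ |z.re - cc| < L + hs}, g₀ ≤ (G w).re) :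
    ∀ t ∈ Icc (0:ℝ) 1,
      0 < ((∑ i, (F ((x₀ : ℂ) + (Y₀ : ℂ) * Complex.I) i -
          F (((x₀ : ℂ) + (Y₀ : ℂ) * Complex.I) + (t : ℂ) *
            ((((x₀ : ℂ) + (Y₀ : ℂ) * Complex.I) + ((hs / 5 : ℝ) : ℂ)) - ((x₀ : ℂ) + (Y₀ : ℂ) * Complex.I))) i) ^ 2) +
        (κ : ℂ) * G (((x₀ : ℂ) + (Y₀ : ℂ) * Complex.I) + (t : ℂ) *
            ((((x₀ : ℂ) + (Y₀ : ℂ) * Complex.I) + ((hs / 5 : ℝ) : ℂ)) - ((x₀ : ℂ) + (Y₀ : ℂ) * Complex.I)))).re := by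
  intro t ht
  set z₀ : ℂ := (x₀ : ℂ) + (Y₀ : ℂ) * Complex.I with hz₀
  have e : z₀ + (t : ℂ) * ((z₀ + ((hs / 5 : ℝ) : ℂ)) - z₀) = z₀ + ((t * (hs / 5) : ℝ) : ℂ) := by push_cast; ring
  rw [e]
  have hζS : z₀ + ((t * (hs / 5) : ℝ) : ℂ) ∈ {z : ℂ | |z.im| < hs ∧ |z.re - cc| < L + hs} := by
    constructor
    · simp [hz₀]; linarith [abs_lt.mp hY]
    · simp [hz₀]
      rw [abs_lt]; constructor <;> nlinarith [ht.1, ht.2, abs_nonneg (x₀ - cc), hx₀cc]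
  have h := corner_right_plateau_re_pos hF hM hunit hhs (x₀ := x₀) (Y := Y₀) (D := t * (hs / 5)) hY hx₀ hx₀cc
    (by nlinarith [ht.1]) (by nlinarith [ht.2]) hκ hg₀ (hG _ hζS)
  have hsq : (∑ i, (F (z₀ + ((t * (hs / 5) : ℝ) : ℂ)) i - F z₀ i) ^ 2) =
      ∑ i, (F z₀ i - F (z₀ + ((t * (hs / 5) : ℝ) : ℂ)) i) ^ 2 := Finset.sum_congr rfl fun i _ => by ring
  rw [hsq] at h
  exact h

/-- **The descent of a corner anchor, in segment form.**  `p = z₀ + hs/5`, `q = x₀ + hs/2` (real); for `0 ≤ Y₀ < hs/4` and `t ∈ [0,1]`: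
`0 < Re(Σᵢ (Fᵢ z₀ − Fᵢ(p + t(q−p)))² + κ·G(p + t(q−p)))` (near `t ≤ 2/5`, middle, far certificates; core of real part `≥ g₀ > 0`). [folklore] -/
theorem right_descent_pos {hs L cc : ℝ} {F : ℂ → (Fin 3 → ℂ)}
    (hF : DifferentiableOn ℂ F {z : ℂ | |z.im| < hs ∧ |z.re - cc| < L + hs})
    (hM : ∀ z ∈ {z : ℂ | |z.im| < hs ∧ |z.re - cc| < L + hs}, ‖deriv F z‖ ≤ 2)
    (hunit : ∀ w ∈ {z : ℂ | |z.im| < hs ∧ |z.re - cc| < L + hs}, ∑ i, (deriv F w i) ^ 2 = 1)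
    {X : ℝ → EuclideanSpace ℝ (Fin 3)} (hX : ContDiff ℝ 1 X) (hXu : ∀ τ, ‖deriv X τ‖ = 1)
    {Rb : ℝ} (hRb0 : 0 ≤ Rb) (hRb : Rb ≤ 1 / 2) (hosc : ∀ τ σ, ‖deriv X τ - deriv X σ‖ ≤ Rb)
    (hFX : ∀ r : ℝ, (r : ℂ) ∈ {z : ℂ | |z.im| < hs ∧ |z.re - cc| < L + hs} →
      F r = fun i => ((⟪X r, EuclideanSpace.single i (1:ℝ)⟫_ℝ : ℝ) : ℂ))
    (hhs : 0 < hs) {x₀ Y₀ : ℝ} (hY0 : 0 ≤ Y₀) (hY : Y₀ < hs / 4) (hx₀ : x₀ < cc + L + hs / 4) (hx₀cc : cc ≤ x₀)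
    {G : ℂ → ℂ} {κ g₀ : ℝ} (hκ : 0 < κ) (hg₀ : 0 < g₀)
    (hG : ∀ w ∈ {z : ℂ | |z.im| < hs ∧ |z.re - cc| < L + hs}, g₀ ≤ (G w).re) :
    ∀ t ∈ Icc (0:ℝ) 1,
      0 < ((∑ i, (F ((x₀ : ℂ) + (Y₀ : ℂ) * Complex.I) i -
          F ((((x₀ + hs / 5 : ℝ) : ℂ) + (Y₀ : ℂ) * Complex.I) + (t : ℂ) *
            (((x₀ + hs / 2 : ℝ) : ℂ) - (((x₀ + hs / 5 : ℝ) : ℂ) + (Y₀ : ℂ) * Complex.I))) i) ^ 2) +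
        (κ : ℂ) * G ((((x₀ + hs / 5 : ℝ) : ℂ) + (Y₀ : ℂ) * Complex.I) + (t : ℂ) *
            (((x₀ + hs / 2 : ℝ) : ℂ) - (((x₀ + hs / 5 : ℝ) : ℂ) + (Y₀ : ℂ) * Complex.I)))).re := by
  intro t ht
  set z₀ : ℂ := (x₀ : ℂ) + (Y₀ : ℂ) * Complex.I with hz₀
  set ζ : ℂ := (((x₀ + hs / 5 : ℝ) : ℂ) + (Y₀ : ℂ) * Complex.I) + (t : ℂ) *
      (((x₀ + hs / 2 : ℝ) : ℂ) - (((x₀ + hs / 5 : ℝ) : ℂ) + (Y₀ : ℂ) * Complex.I)) with hζ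
  have eζ : ζ = (((x₀ + (hs / 5 + 3 * hs / 10 * t)) : ℝ) : ℂ) + ((Y₀ * (1 - t) : ℝ) : ℂ) * Complex.I := by
    rw [hζ]; push_cast; ring
  have eζ' : ζ = z₀ + ((((hs / 5 + 3 * hs / 10 * t : ℝ) : ℂ)) - ((Y₀ * t : ℝ) : ℂ) * Complex.I) := by
    rw [hζ, hz₀]; push_cast; ring
  have hζS : ζ ∈ {z : ℂ | |z.im| < hs ∧ |z.re - cc| < L + hs} := by
    rw [eζ]
    constructor
    · simp
      rw [abs_of_nonneg hY0, abs_of_nonneg (sub_nonneg.mpr ht.2)]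
      nlinarith [ht.1, ht.2]
    · simp
      rw [abs_lt]; constructor <;> nlinarith [ht.1, ht.2, hx₀cc]
  have hGζ : 0 ≤ ((κ : ℂ) * G ζ).re := by
    rw [Complex.re_ofReal_mul]; exact mul_nonneg hκ.le (hg₀.le.trans (hG ζ hζS))
  have hsq : ∀ w : ℂ, (∑ i, (F w i - F z₀ i) ^ 2) = ∑ i, (F z₀ i - F w i) ^ 2 :=
    fun w => Finset.sum_congr rfl fun i _ => by ring
  rcases le_or_gt t (2 / 5) with h1 | h1
  · -- near sources
    have h := corner_right_descent_near_re_pos hF hM hunit hhs (x₀ := x₀) (Y := Y₀) (f := t) hY0 hY hx₀ hx₀cc ht.1 h1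
      hκ hg₀ (hG ζ hζS)
    rw [← eζ', hsq] at h
    exact h
  rcases le_or_gt t (11 / 20) with h2 | h2
  · -- middle sources
    have h := corner_right_descent_mid_re_ge hF hM hunit hhs (x₀ := x₀) (Y := Y₀) (f := t) hY0 hY hx₀ hx₀cc h1.le h2
    rw [← eζ, hsq] at h
    rw [Complex.add_re]
    have : 0 < (0.06 * hs) ^ 2 := by positivity
    linarith
  · -- far sources
    have h := corner_right_descent_far_re_ge hF hM hunit hX hXu hRb0 hRb hosc hFX hhs (x₀ := x₀) (Y := Y₀) (f := t)
      hY0 hY hx₀ hx₀cc h2.le ht.2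
    rw [← eζ, hsq] at h
    rw [Complex.add_re]
    have : 0 < (0.007 * hs) ^ 2 := by positivity
    linarith

/-- The right wing of a corner anchor lies in the stadium: plateau and descent sources. [folklore] -/
theorem right_wing_in_stadium {hs L cc x₀ Y₀ : ℝ} (hhs : 0 < hs) (hY : |Y₀| < hs / 4) (hx₀ : x₀ < cc + L + hs / 4)
    (hx₀cc : cc ≤ x₀) :
    (∀ t ∈ Icc (0:ℝ) 1, ((x₀ : ℂ) + (Y₀ : ℂ) * Complex.I) + (t : ℂ) *
        ((((x₀ : ℂ) + (Y₀ : ℂ) * Complex.I) + ((hs / 5 : ℝ) : ℂ)) - ((x₀ : ℂ) + (Y₀ : ℂ) * Complex.I)) ∈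
        {z : ℂ | |z.im| < hs ∧ |z.re - cc| < L + hs}) ∧
    (∀ t ∈ Icc (0:ℝ) 1, (((x₀ + hs / 5 : ℝ) : ℂ) + (Y₀ : ℂ) * Complex.I) + (t : ℂ) *
        (((x₀ + hs / 2 : ℝ) : ℂ) - (((x₀ + hs / 5 : ℝ) : ℂ) + (Y₀ : ℂ) * Complex.I)) ∈
        {z : ℂ | |z.im| < hs ∧ |z.re - cc| < L + hs}) := by
  have hY' := abs_lt.mp hY
  refine ⟨fun t ht => ?_, fun t ht => ?_⟩
  · have e : ((x₀ : ℂ) + (Y₀ : ℂ) * Complex.I) + (t : ℂ) *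
        ((((x₀ : ℂ) + (Y₀ : ℂ) * Complex.I) + ((hs / 5 : ℝ) : ℂ)) - ((x₀ : ℂ) + (Y₀ : ℂ) * Complex.I)) =
        (((x₀ + t * (hs / 5)) : ℝ) : ℂ) + (Y₀ : ℂ) * Complex.I := by push_cast; ring
    rw [e]
    constructor
    · simp; rw [abs_lt]; constructor <;> linarith
    · simp; rw [abs_lt]; constructor <;> nlinarith [ht.1, ht.2]
  · have e : (((x₀ + hs / 5 : ℝ) : ℂ) + (Y₀ : ℂ) * Complex.I) + (t : ℂ) *
        (((x₀ + hs / 2 : ℝ) : ℂ) - (((x₀ + hs / 5 : ℝ) : ℂ) + (Y₀ : ℂ) * Complex.I)) =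
        (((x₀ + (hs / 5 + 3 * hs / 10 * t)) : ℝ) : ℂ) + ((Y₀ * (1 - t) : ℝ) : ℂ) * Complex.I := by push_cast; ring
    rw [e]
    constructor
    · simp
      have h1t : |1 - t| ≤ 1 := by rw [abs_le]; constructor <;> linarith [ht.1, ht.2]
      calc |Y₀| * |1 - t| ≤ |Y₀| * 1 := mul_le_mul_of_nonneg_left h1t (abs_nonneg _)
        _ < hs := by linarith
    · simp; rw [abs_lt]; constructor <;> nlinarith [ht.1, ht.2]

end Summit.NavierStokesRegularity.NavierStokesRegularity.Theorems.StadiumRightWingPos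

end
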